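import Mathlib.MeasureTheory.Constructions.Polish.Basic
import Literature.Probability.RandomPlanarGeometry.StochDominatedLimit
import HarnessLib

/-!
# The abstract two-sided stochastic squeeze: sequential forms, antisymmetry, pull-back

Topic `Literature/Probability/RandomPlanarGeometry`, companion of `StochDominatedLimit.lean` (Hall/
Strassen domination `StochDominatedAlong` along a closed relation passes to weak limits).  A
*two-sided stochastic squeeze* identifies an unknown law `μ` from `λₙ⁻ ≼ μ ≼ λₙ⁺` with
`λₙ^± → λ`: (1) pass the order to the limit (`λ ≼ μ ≼ λ` on measurable sets —
`StochDominatedLimit.lean`, here repackaged in the sequential test-function form consumed by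
`IsSubseqLimitLaw`); (2) antisymmetry: mutual domination on a generating π-system of up-sets
forces equality of finite measures (`measure_eq_of_dominated_of_dominated_on_piSystem`); (3) when
the order only sees a derived statistic `F` (e.g. the side region of a chord rather than the
chord), pull the identification `μ.map F = λ.map F` back through a set on which `F` is injective
and which carries both laws (`measure_eq_of_map_eq_of_injOn`, Lusin–Souslin).  Route
`CriticalPhenomena/SAWTargetMonotonicity` (endpoint squeeze of the critical SAW toward a boundary
target between the SLE_{8/3} laws toward neighbouring targets) is the motivating consumer; every
statement here is abstract measure theory.

## Contents

* `measure_le_relImage_of_forall_integral_tendsto[_of_antitone]`,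
  `StochDominatedAlong.measure_le_of_forall_integral_tendsto[_of_antitone]` — step (1), sequential
  test-function forms of the closure theorem (`∫ f dμₙ → ∫ f dμ` for bounded continuous `f`).
* `StochDominatedAlong.measure_map_le` — step (0): Hall inequalities push forward along
  measurable statistics (measurable sets), the input form of the closure theorems;
  `SAW.IsTargetOrdered.map_curve_le` — the SAW instance (chord laws ↦ curve laws).
* `measure_eq_of_dominated_of_dominated_on_piSystem`,
  `StochDominatedAlong.measure_eq_of_antisymm_on_piSystem` — step (2).
* `measure_eq_of_squeeze` — steps (1) + (2): `lo n ≼ μ ≼ hi n` with `lo n, hi n → λ` forces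
  `μ = λ`.
* `measure_eq_of_map_eq_of_injOn` — step (3).

## References

* T. Kamae, U. Krengel, G. L. O'Brien, *Stochastic inequalities on partially ordered spaces*,
  Ann. Probab. 5 (1977), 899–912.
* T. M. Liggett, *Interacting particle systems* (1985/2005), Ch. II, §2 (order via up-sets).
* A. S. Kechris, *Classical descriptive set theory* (1995), Thm. 15.1 (Lusin–Souslin), as in
  Mathlib's `MeasurableSet.image_of_measurable_injOn`.
-/

noncomputable section

open MeasureTheory Filter Set Metric Literature.Probability.LatticeModels
open scoped Topology ENNReal NNReal BoundedContinuousFunction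

namespace Literature.Probability.RandomPlanarGeometry

variable {X Y : Type*} [PseudoMetricSpace X] [PseudoMetricSpace Y]

section Sequential

variable [MeasurableSpace X] [OpensMeasurableSpace X] [MeasurableSpace Y] [OpensMeasurableSpace Y]

/-! ### Sequential test-function forms (the interface of `IsSubseqLimitLaw`) -/

/-- **Sequential test-function form.** If `∫ f dμₙ → ∫ f dμ` and `∫ g dνₙ → ∫ g dν` for all
bounded continuous `f`, `g` (probability measures), the Hall inequalities `μₙ U ≤ νₙ (R[U])` hold
for all open `U` and all large `n`, and the graph of `R` is closed, then `μ A ≤ ν (R[A])` for every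
measurable `A` (the limit `μ` being inner regular, e.g. on a Polish space). [folklore] -/
theorem measure_le_relImage_of_forall_integral_tendsto {R : X → Y → Prop}
    (hR : IsClosed {p : X × Y | R p.1 p.2})
    {μs : ℕ → Measure X} {μ : Measure X} [hμs : ∀ n, IsProbabilityMeasure (μs n)]
    [hμ' : IsProbabilityMeasure μ]
    {νs : ℕ → Measure Y} {ν : Measure Y} [hνs : ∀ n, IsProbabilityMeasure (νs n)]
    [hν' : IsProbabilityMeasure ν]
    (hμ : ∀ f : X →ᵇ ℝ, Tendsto (fun n => ∫ x, f x ∂μs n) atTop (𝓝 (∫ x, f x ∂μ)))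
    (hν : ∀ g : Y →ᵇ ℝ, Tendsto (fun n => ∫ y, g y ∂νs n) atTop (𝓝 (∫ y, g y ∂ν)))
    (h : ∀ᶠ n in atTop, ∀ U : Set X, IsOpen U → μs n U ≤ νs n {y | ∃ x ∈ U, R x y})
    [hreg : μ.InnerRegularCompactLTTop] {A : Set X} (hA : MeasurableSet A) :
    μ A ≤ ν {y | ∃ x ∈ A, R x y} := by
  -- repackage as `ProbabilityMeasure`-valued sequences converging in the weak topology
  let P : ℕ → ProbabilityMeasure X := fun n => ⟨μs n, hμs n⟩
  let P₀ : ProbabilityMeasure X := ⟨μ, hμ'⟩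
  let Q : ℕ → ProbabilityMeasure Y := fun n => ⟨νs n, hνs n⟩
  let Q₀ : ProbabilityMeasure Y := ⟨ν, hν'⟩
  have hP : Tendsto P atTop (𝓝 P₀) := ProbabilityMeasure.tendsto_iff_forall_integral_tendsto.2 hμ
  have hQ : Tendsto Q atTop (𝓝 Q₀) := ProbabilityMeasure.tendsto_iff_forall_integral_tendsto.2 hν
  have h' : ∀ᶠ n in atTop, ∀ U : Set X, IsOpen U →
      (P n : Measure X) U ≤ (Q n : Measure Y) {y | ∃ x ∈ U, R x y} := h
  haveI : (P₀ : Measure X).InnerRegularCompactLTTop := hreg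
  exact measure_le_relImage_of_tendsto_of_measurableSet hR hP hQ h' hA

/-- **Sequential test-function form, decreasing closed relations.** [folklore] -/
theorem measure_le_relImage_of_forall_integral_tendsto_of_antitone {R : ℕ → X → Y → Prop}
    (hR : ∀ k, IsClosed {p : X × Y | R k p.1 p.2}) (hanti : ∀ k l, k ≤ l → ∀ x y, R l x y → R k x y)
    {S : ℕ → X → Y → Prop} (hS : ∀ k, ∀ᶠ n in atTop, ∀ x y, S n x y → R k x y)
    {μs : ℕ → Measure X} {μ : Measure X} [hμs : ∀ n, IsProbabilityMeasure (μs n)]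
    [hμ' : IsProbabilityMeasure μ]
    {νs : ℕ → Measure Y} {ν : Measure Y} [hνs : ∀ n, IsProbabilityMeasure (νs n)]
    [hν' : IsProbabilityMeasure ν]
    (hμ : ∀ f : X →ᵇ ℝ, Tendsto (fun n => ∫ x, f x ∂μs n) atTop (𝓝 (∫ x, f x ∂μ)))
    (hν : ∀ g : Y →ᵇ ℝ, Tendsto (fun n => ∫ y, g y ∂νs n) atTop (𝓝 (∫ y, g y ∂ν)))
    (h : ∀ᶠ n in atTop, ∀ U : Set X, IsOpen U → μs n U ≤ νs n {y | ∃ x ∈ U, S n x y})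
    [hreg : μ.InnerRegularCompactLTTop] {A : Set X} (hA : MeasurableSet A) :
    μ A ≤ ν {y | ∃ x ∈ A, ∀ k, R k x y} := by
  let P : ℕ → ProbabilityMeasure X := fun n => ⟨μs n, hμs n⟩
  let P₀ : ProbabilityMeasure X := ⟨μ, hμ'⟩
  let Q : ℕ → ProbabilityMeasure Y := fun n => ⟨νs n, hνs n⟩
  let Q₀ : ProbabilityMeasure Y := ⟨ν, hν'⟩
  have hP : Tendsto P atTop (𝓝 P₀) := ProbabilityMeasure.tendsto_iff_forall_integral_tendsto.2 hμ
  have hQ : Tendsto Q atTop (𝓝 Q₀) := ProbabilityMeasure.tendsto_iff_forall_integral_tendsto.2 hν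
  have h' : ∀ᶠ n in atTop, ∀ U : Set X, IsOpen U →
      (P n : Measure X) U ≤ (Q n : Measure Y) {y | ∃ x ∈ U, S n x y} := h
  haveI : (P₀ : Measure X).InnerRegularCompactLTTop := hreg
  exact measure_le_relImage_of_tendsto_of_antitone_of_measurableSet hR hanti hS hP hQ h' hA

end Sequential

namespace StochDominatedAlong

variable [MeasurableSpace X] [OpensMeasurableSpace X] [MeasurableSpace Y] [OpensMeasurableSpace Y]

/-- **Sequential test-function form** from `StochDominatedAlong` at the stages. [folklore] -/
theorem measure_le_of_forall_integral_tendsto {R : X → Y → Prop}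
    (hR : IsClosed {p : X × Y | R p.1 p.2})
    {μs : ℕ → Measure X} {μ : Measure X} [∀ n, IsProbabilityMeasure (μs n)]
    [IsProbabilityMeasure μ]
    {νs : ℕ → Measure Y} {ν : Measure Y} [∀ n, IsProbabilityMeasure (νs n)]
    [IsProbabilityMeasure ν]
    (hμ : ∀ f : X →ᵇ ℝ, Tendsto (fun n => ∫ x, f x ∂μs n) atTop (𝓝 (∫ x, f x ∂μ)))
    (hν : ∀ g : Y →ᵇ ℝ, Tendsto (fun n => ∫ y, g y ∂νs n) atTop (𝓝 (∫ y, g y ∂ν)))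
    (h : ∀ᶠ n in atTop, StochDominatedAlong R (μs n) (νs n))
    [μ.InnerRegularCompactLTTop] {A : Set X} (hA : MeasurableSet A) :
    μ A ≤ ν {y | ∃ x ∈ A, R x y} :=
  measure_le_relImage_of_forall_integral_tendsto hR hμ hν (h.mono fun _ hi U _ => hi U) hA

/-- **Sequential test-function form, decreasing closed relations**, from `StochDominatedAlong` at
the stages. [folklore] -/
theorem measure_le_of_forall_integral_tendsto_of_antitone {R : ℕ → X → Y → Prop}
    (hR : ∀ k, IsClosed {p : X × Y | R k p.1 p.2}) (hanti : ∀ k l, k ≤ l → ∀ x y, R l x y → R k x y)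
    {S : ℕ → X → Y → Prop} (hS : ∀ k, ∀ᶠ n in atTop, ∀ x y, S n x y → R k x y)
    {μs : ℕ → Measure X} {μ : Measure X} [∀ n, IsProbabilityMeasure (μs n)]
    [IsProbabilityMeasure μ]
    {νs : ℕ → Measure Y} {ν : Measure Y} [∀ n, IsProbabilityMeasure (νs n)]
    [IsProbabilityMeasure ν]
    (hμ : ∀ f : X →ᵇ ℝ, Tendsto (fun n => ∫ x, f x ∂μs n) atTop (𝓝 (∫ x, f x ∂μ)))
    (hν : ∀ g : Y →ᵇ ℝ, Tendsto (fun n => ∫ y, g y ∂νs n) atTop (𝓝 (∫ y, g y ∂ν)))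
    (h : ∀ᶠ n in atTop, StochDominatedAlong (S n) (μs n) (νs n))
    [μ.InnerRegularCompactLTTop] {A : Set X} (hA : MeasurableSet A) :
    μ A ≤ ν {y | ∃ x ∈ A, ∀ k, R k x y} :=
  measure_le_relImage_of_forall_integral_tendsto_of_antitone hR hanti hS hμ hν
    (h.mono fun _ hi U _ => hi U) hA

/-- **Hall inequalities push forward** (step (0) of the squeeze: from the discrete configuration
spaces to the space of observed objects). If `μ ≼_R ν` and `f`, `g` are (a.e.-)measurable
statistics, then `(μ.map f) A ≤ (ν.map g) (R'[A])` for every MEASURABLE `A`, where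
`R' x' y' :⟺ ∃ x y, f x = x' ∧ g y = y' ∧ R x y` is the image relation — exactly the hypothesis
form (Hall inequalities on open/measurable sets at the stages) of the closure theorems. [folklore] -/
theorem measure_map_le {α β α' β' : Type*} [MeasurableSpace α] [MeasurableSpace β]
    [MeasurableSpace α'] [MeasurableSpace β'] {R : α → β → Prop} {μ : Measure α} {ν : Measure β}
    (h : StochDominatedAlong R μ ν) {f : α → α'} {g : β → β'} (hf : Measurable f)
    (hg : AEMeasurable g ν) {A : Set α'} (hA : MeasurableSet A) :
    μ.map f A ≤ ν.map g {y' | ∃ x' ∈ A, ∃ x y, f x = x' ∧ g y = y' ∧ R x y} := by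
  rw [Measure.map_apply hf hA]
  refine (h (f ⁻¹' A)).trans ((measure_mono ?_).trans (Measure.le_map_apply hg _))
  rintro y ⟨x, hx, hxy⟩
  exact ⟨f x, hx, x, y, rfl, rfl, hxy⟩

end StochDominatedAlong

/-- **SAW instance of the push-forward step.** If the critical SAW chord laws of `Ω_δ` from `a`
are target ordered from `b` to `c` along the connector `κ` (`SAW.IsTargetOrdered`, Hall form on the
discrete chord spaces), then the push-forward CURVE laws satisfy the Hall inequalities on every
measurable set of curve classes along the image relation "some representing chords are weakly
beyond each other" — the stage hypothesis of the closure theorems. [folklore] -/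
theorem SAW.IsTargetOrdered.map_curve_le {Ω : Set ℂ} {δ : ℝ} {a b c : Site 2} {κ : List ℂ}
    (h : SAW.IsTargetOrdered Ω δ a b c κ) {A : Set (CurveClass ℂ)} (hA : MeasurableSet A) :
    (SAW.law Ω δ a b).map SAW.DomainSAW.curve A ≤
      (SAW.law Ω δ a c).map SAW.DomainSAW.curve {y | ∃ x ∈ A,
        ∃ (γ : SAW.DomainSAW Ω δ a b) (γ' : SAW.DomainSAW Ω δ a c),
          γ.curve = x ∧ γ'.curve = y ∧ SAW.WeaklyBeyond κ γ γ'} :=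
  StochDominatedAlong.measure_map_le h (SAW.DomainSAW.measurable_of_top _)
    (SAW.DomainSAW.measurable_of_top _).aemeasurable hA

/-! ### Antisymmetry on a determining π-system of up-sets (the squeeze step) -/

/-- **Antisymmetry of the stochastic order on a determining class.** Let `C` be a π-system of
`r`-up-sets generating the σ-algebra. If two finite measures of equal total mass dominate each
other along `r` ON THE SETS OF `C` (`μ s ≤ ν (r[s])` and `ν s ≤ μ (r[s])` for `s ∈ C`; e.g. the
output of `measure_le_relImage_of_tendsto_of_measurableSet` in both directions), then `μ = ν`:
for an up-set `r[s] ⊆ s`, so `μ s = ν s` on `C`, and finite measures agreeing on a generating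
π-system and on `univ` are equal. With `C` the hitting events of a random closed set
(Choquet–Matheron) this is the uniqueness step of a two-sided stochastic squeeze.
(Liggett Ch. II, Def. 2.1: the order is defined through up-sets.) [folklore] -/
theorem measure_eq_of_dominated_of_dominated_on_piSystem {α : Type*} [m : MeasurableSpace α]
    {r : α → α → Prop} (C : Set (Set α)) (hgen : m = MeasurableSpace.generateFrom C)
    (hpi : IsPiSystem C) (hup : ∀ s ∈ C, ∀ x y, x ∈ s → r x y → y ∈ s)
    {μ ν : Measure α} [IsFiniteMeasure μ] (huniv : μ univ = ν univ)
    (h₁ : ∀ s ∈ C, μ s ≤ ν {y | ∃ x ∈ s, r x y}) (h₂ : ∀ s ∈ C, ν s ≤ μ {y | ∃ x ∈ s, r x y}) :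
    μ = ν := by
  have himg : ∀ s ∈ C, {y | ∃ x ∈ s, r x y} ⊆ s := fun s hs y ⟨x, hx, hxy⟩ => hup s hs x y hx hxy
  refine ext_of_generate_finite C hgen hpi (fun s hs => le_antisymm ?_ ?_) huniv
  · exact (h₁ s hs).trans (measure_mono (himg s hs))
  · exact (h₂ s hs).trans (measure_mono (himg s hs))

/-- The same with full Hall/Strassen domination in both directions (`StochDominatedAlong r μ ν` and
`StochDominatedAlong r ν μ`). [folklore] -/
theorem StochDominatedAlong.measure_eq_of_antisymm_on_piSystem {α : Type*} [m : MeasurableSpace α]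
    {r : α → α → Prop} (C : Set (Set α)) (hgen : m = MeasurableSpace.generateFrom C)
    (hpi : IsPiSystem C) (hup : ∀ s ∈ C, ∀ x y, x ∈ s → r x y → y ∈ s)
    {μ ν : Measure α} [IsFiniteMeasure μ] (huniv : μ univ = ν univ)
    (h₁ : StochDominatedAlong r μ ν) (h₂ : StochDominatedAlong r ν μ) : μ = ν :=
  measure_eq_of_dominated_of_dominated_on_piSystem C hgen hpi hup huniv (fun s _ => h₁ s)
    fun s _ => h₂ s

/-! ### The two-sided squeeze: steps (1) + (2) together -/

/-- **Identification by a two-sided stochastic squeeze.** Let `r` be a relation on a metric Borel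
space `X` with closed graph, `C` a generating π-system of `r`-up-sets, and `μ`, `λ` probability
measures (inner regular, e.g. `X` Polish). If probability measures `lo n → λ` and `hi n → λ`
weakly (bounded continuous test functions) while, for all large `n`, the Hall inequalities
`lo n U ≤ μ (r[U])` and `μ U ≤ hi n (r[U])` hold for every open `U` (`lo n ≼ μ ≼ hi n`), then
`μ = λ`. Proof: by the closure theorem with one constant sequence, `λ A ≤ μ (r[A])` and
`μ A ≤ λ (r[A])` for measurable `A`; then antisymmetry on `C`. (The shape of "a law sandwiched
between the SLE laws toward targets `b⁻ → b ← b⁺` is the SLE law toward `b`", with the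
continuity of the reference family in the parameter supplying `lo n, hi n → λ`.) [folklore] -/
theorem measure_eq_of_squeeze {X : Type*} [PseudoMetricSpace X] [m : MeasurableSpace X]
    [OpensMeasurableSpace X] {r : X → X → Prop} (hr : IsClosed {p : X × X | r p.1 p.2})
    (C : Set (Set X)) (hgen : m = MeasurableSpace.generateFrom C) (hpi : IsPiSystem C)
    (hup : ∀ s ∈ C, ∀ x y, x ∈ s → r x y → y ∈ s)
    {μ lam : Measure X} [IsProbabilityMeasure μ] [IsProbabilityMeasure lam]
    [μ.InnerRegularCompactLTTop] [lam.InnerRegularCompactLTTop]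
    {lo hi : ℕ → Measure X} [∀ n, IsProbabilityMeasure (lo n)] [∀ n, IsProbabilityMeasure (hi n)]
    (hlo : ∀ f : X →ᵇ ℝ, Tendsto (fun n => ∫ x, f x ∂lo n) atTop (𝓝 (∫ x, f x ∂lam)))
    (hhi : ∀ f : X →ᵇ ℝ, Tendsto (fun n => ∫ x, f x ∂hi n) atTop (𝓝 (∫ x, f x ∂lam)))
    (h₁ : ∀ᶠ n in atTop, ∀ U : Set X, IsOpen U → lo n U ≤ μ {y | ∃ x ∈ U, r x y})
    (h₂ : ∀ᶠ n in atTop, ∀ U : Set X, IsOpen U → μ U ≤ hi n {y | ∃ x ∈ U, r x y}) :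
    μ = lam := by
  have hconst : ∀ f : X →ᵇ ℝ, Tendsto (fun _ : ℕ => ∫ x, f x ∂μ) atTop (𝓝 (∫ x, f x ∂μ)) :=
    fun _ => tendsto_const_nhds
  -- (1) the order passes to the limit, in both directions
  have hlam : ∀ A : Set X, MeasurableSet A → lam A ≤ μ {y | ∃ x ∈ A, r x y} := fun A hA =>
    measure_le_relImage_of_forall_integral_tendsto (μs := lo) (νs := fun _ => μ) hr hlo hconst h₁ hA
  have hmu : ∀ A : Set X, MeasurableSet A → μ A ≤ lam {y | ∃ x ∈ A, r x y} := fun A hA =>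
    measure_le_relImage_of_forall_integral_tendsto (μs := fun _ => μ) (νs := hi) hr hconst hhi h₂ hA
  -- (2) antisymmetry on the generating π-system of up-sets (whose members are measurable)
  have hCmeas : ∀ s ∈ C, MeasurableSet s := fun s hs => by
    rw [hgen]; exact MeasurableSpace.measurableSet_generateFrom hs
  refine measure_eq_of_dominated_of_dominated_on_piSystem C hgen hpi hup (by simp)
    (fun s hs => hmu s (hCmeas s hs)) fun s hs => hlam s (hCmeas s hs)

/-! ### Pull-back of an identification through an almost surely injective statistic -/

/-- **Two measures with the same image under a statistic that is injective on a set carrying both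
are equal** (standard Borel source, countably separated target; Lusin–Souslin). If `F` is
measurable, injective on the measurable set `S`, `μ Sᶜ = 0 = ν Sᶜ` and `μ.map F = ν.map F`, then
`μ = ν`: for measurable `A`, `F '' (A ∩ S)` is measurable (`MeasurableSet.image_of_measurable_injOn`)
and `S ∩ F ⁻¹' (F '' (A ∩ S)) = A ∩ S`. (The last step of a squeeze that identifies the law of a
derived object — e.g. the side region of a simple chord — rather than of the object itself.)
[folklore] -/
theorem measure_eq_of_map_eq_of_injOn {γ α : Type*} [MeasurableSpace γ] [StandardBorelSpace γ]
    [MeasurableSpace α] [MeasurableSpace.CountablySeparated α] {F : γ → α} (hF : Measurable F)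
    {S : Set γ} (hS : MeasurableSet S) (hinj : InjOn F S) {μ ν : Measure γ} (hμS : μ Sᶜ = 0)
    (hνS : ν Sᶜ = 0) (h : μ.map F = ν.map F) : μ = ν := by
  -- a measure carried by `S` sees only `A ∩ S`
  have hcarried : ∀ (ρ : Measure γ), ρ Sᶜ = 0 → ∀ A : Set γ, ρ A = ρ (A ∩ S) := by
    intro ρ hρ A
    refine le_antisymm ?_ (measure_mono inter_subset_left)
    calc ρ A ≤ ρ (A ∩ S) + ρ (A \ S) := measure_le_inter_add_sdiff ρ A S
      _ ≤ ρ (A ∩ S) + ρ Sᶜ := add_le_add le_rfl (measure_mono fun x hx => hx.2)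
      _ = ρ (A ∩ S) := by rw [hρ, add_zero]
  refine Measure.ext fun A hA => ?_
  set B : Set α := F '' (A ∩ S) with hB
  have hBm : MeasurableSet B := (hA.inter hS).image_of_measurable_injOn hF (hinj.mono inter_subset_right)
  have hpre : F ⁻¹' B ∩ S = A ∩ S := by
    ext x
    constructor
    · rintro ⟨⟨y, hy, hyx⟩, hxS⟩
      have : y = x := hinj hy.2 hxS hyx
      subst this
      exact ⟨hy.1, hxS⟩
    · rintro ⟨hxA, hxS⟩
      exact ⟨⟨x, ⟨hxA, hxS⟩, rfl⟩, hxS⟩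
  have key : ∀ (ρ : Measure γ), ρ Sᶜ = 0 → ρ A = ρ.map F B := by
    intro ρ hρ
    rw [Measure.map_apply hF hBm, hcarried ρ hρ A, hcarried ρ hρ (F ⁻¹' B), hpre]
  rw [key μ hμS, key ν hνS, h]

end Literature.Probability.RandomPlanarGeometry

end
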